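import Literature.MathematicalPhysics.KineticTheory.InfiniteChainStates
import Literature.MathematicalPhysics.KineticTheory.ZeroWavenumberSpace
import Literature.MathematicalPhysics.KineticTheory.InfiniteChainSuperstableDynamics
import Summits.AtomisticToContinuum.FouriersLaw.Theorems.EmbeddedDrudeMourreAbelThermodynamicLimitFixedTimeOffsetMatchingProductForm

/-!
# Stub (B′|E1,M1sev) `stub_uniformFixedTimeOffsetMatchingOfEngines`, part 2: the static identification — the
truncated two-current functional is ONE window observable, read by the finite chain through the anchored window and by
the infinite chain through `boxPhaseAt`
(crux `LatticeLandauDamping.AbelThermodynamicLimit`, item stmt-AtomisticToContinuum-14013, line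
`series-law-at-every-laplace-frequency` (SketchIdeator2); `--supports` helper file, closes nothing)

The static engine (E1) `stub_bulkWindowEquivalence` of the coupling stub compares `E_{μ_{N,T}}[f(q, p on [i₀, i₀+m])]`
with `E_{μT}[f ∘ boxPhaseAt 0 m]` for bounded measurable `f` on `PhaseSpace (m+1)`. After the dynamical engine (M1sev)
has replaced the open-chain semigroup by LLL's severed flow `T^Λ_t` of the bond window `Λ = [k-M, k+1+M]` (read on the
finite configuration embedded in `ℤ → ℝ × ℝ`), both sides of (B′) are expectations of the functional
`G(σ) = g_A(j_0(σ)) · g_B(j_x(T^{[x-M,x+1+M]}_t σ))`, which depends on the sites of the window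
`[-a, b]`, `a ≥ M+1-x`, `b ≥ max(1, x+M+2)` only (locality of the severed flow, `severedFlow_apply_eq_of_forall_eq`).
This file supplies:

* §1 translation covariance of the severed flow, `T^Λ_t (τ_c σ) = τ_c (T^{Λ+c}_t σ)` (uniqueness of severed solutions);
* §2 `exists_windowObservable`: for margins `a ≥ M+1-x`, `b ≥ max(1, x+M+2)`, a measurable `f` on `PhaseSpace (a+b+1)` with
  `f ∘ boxPhaseAt (-a) (a+b) = G` (infinite chain) and, for every anchor `i` with `k = i + x` and the window
  `[i-a, i+b]` inside the chain, `f(q, p on [i-a, i+b]) = g_A(j_i(z)) · g_B(j_k(T^{[k-M,k+1+M]}_t (ι_N z)))` with the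
  stub's `dite` embedding `ι_N` (finite chain) — the format of (E1) at the anchor `i₀ = i - a`;
* §3 for a shift-invariant state the `boxPhaseAt (-a)`- and `boxPhaseAt 0`-expectations agree;
* the registered closed form `pinnedChain_windowObservable`.

All statements proved; `[folklore]`. No definitions.
-/

noncomputable section

namespace Summit.AtomisticToContinuum.FouriersLaw.Theorems.AbelThermodynamicLimit.SeriesLawAtEveryLaplaceFrequency

open MeasureTheory Set Filter Topology Function
open Literature.MathematicalPhysics.KineticTheory Literature.MathematicalPhysics.KineticTheory.HeatConduction
open OscillatorChain
open Summit.AtomisticToContinuum.FouriersLaw.Theorems.AbelThermodynamicLimit.LoomisCompactHorizonWitness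
  (severedFlow_apply_eq_of_forall_eq)

namespace OffsetMatching

variable {P : OscillatorChain}

/-! ### §1 Translation covariance of the severed flow -/

/-- **Translation covariance of the severed flow**: `T^Λ_t (τ_c σ) = τ_c (T^{Λ+c}_t σ)` for the lattice translations
`(τ_c σ)_i = σ_{i+c}` (the right side is a severed solution for `Λ` from `τ_c σ`, since the forces are translation
covariant; uniqueness of severed solutions for `C²` potentials). [folklore] -/
theorem severedFlow_chainShift (hB1 : P.CondB1) (hU : ContDiff ℝ 2 P.U) (hV : ContDiff ℝ 2 P.V)
    (Λ : Finset ℤ) (c : ℤ) (t : ℝ) (σ : ChainConfig) :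
    severedFlow hB1 Λ t (chainShift c σ) =
      chainShift c (severedFlow hB1 (Λ.map (addRightEmbedding c)) t σ) := by
  set Λ' : Finset ℤ := Λ.map (addRightEmbedding c) with hΛ'
  have hmem : ∀ y : ℤ, y + c ∈ Λ' ↔ y ∈ Λ := fun y => by
    rw [hΛ', ← addRightEmbedding_apply c y, Finset.mem_map' (addRightEmbedding c)]
  set g : ℝ → ChainConfig := fun s => chainShift c (severedFlow hB1 Λ' s σ) with hg
  have hsol' := isSeveredSolution_severedFlow hB1 Λ' σ
  have hgsol : P.IsSeveredSolution Λ g := by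
    refine ⟨fun y hy s => ?_, fun y hy s => ?_⟩
    · have hy' : y + c ∈ Λ' := (hmem y).2 hy
      obtain ⟨h1, h2⟩ := hsol'.1 (y + c) hy' s
      have eF : P.force (g s) y = P.force (severedFlow hB1 Λ' s σ) (y + c) := by
        rw [hg]; exact force_chainShift P _ c y
      rw [eF]
      exact ⟨h1, h2⟩
    · have hy' : y + c ∉ Λ' := fun h => hy ((hmem y).1 h)
      show chainShift c (severedFlow hB1 Λ' s σ) y = chainShift c (severedFlow hB1 Λ' 0 σ) y
      rw [chainShift_apply, chainShift_apply, severedFlow_apply_of_not_mem hB1 Λ' s σ hy', severedFlow_zero]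
  have hg0 : g 0 = chainShift c σ := by
    rw [hg]; dsimp only; rw [severedFlow_zero]
  have key := hgsol.eq_severedFlow (hB1 := hB1) hU hV t
  rw [hg0] at key
  exact key.symm

/-- Translating the bond window: `[x-M, x+1+M] + i = [k-M, k+1+M]` for `k = i + x`. [folklore] -/
theorem bondWindow_map_addRight (x i k : ℤ) (M : ℕ) (hk : k = i + x) :
    (Finset.Icc (x - M) (x + 1 + M)).map (addRightEmbedding i) = Finset.Icc (k - M) (k + 1 + M) := by
  rw [Finset.map_add_right_Icc, hk]
  congr 1 <;> ring

/-! ### §2 The window observable -/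

/-- **Locality of the two-current functional.** `G(σ) = g_A(j_0(σ)) · g_B(j_x(T^{[x-M,x+1+M]}_t σ))` only depends on the
sites of `[-a, b]` whenever `-a ≤ min(0, x-M-1)` and `max(1, x+M+2) ≤ b` (the current `j_y` reads the sites `y, y+1`;
the severed flow on its window reads the window and its two outer neighbours, `severedFlow_apply_eq_of_forall_eq`).
[folklore] -/
theorem twoCurrent_eq_of_forall_eq (hB1 : P.CondB1) (hU : ContDiff ℝ 2 P.U) (hV : ContDiff ℝ 2 P.V)
    (gA gB : ℝ → ℝ) (x : ℤ) (M : ℕ) (t : ℝ) {lo hi : ℤ} (hlo0 : lo ≤ 0) (hlox : lo ≤ x - M - 1)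
    (hhi1 : 1 ≤ hi) (hhix : x + M + 2 ≤ hi) {σ σ' : ChainConfig} (h : ∀ y : ℤ, lo ≤ y → y ≤ hi → σ y = σ' y) :
    gA (P.bondCurrentZ σ 0) * gB (P.bondCurrentZ (severedFlow hB1 (Finset.Icc (x - M) (x + 1 + M)) t σ) x) =
      gA (P.bondCurrentZ σ' 0) *
        gB (P.bondCurrentZ (severedFlow hB1 (Finset.Icc (x - M) (x + 1 + M)) t σ') x) := by
  have h0 : σ 0 = σ' 0 := h 0 hlo0 (by omega)
  have h1 : σ (0 + 1) = σ' (0 + 1) := h (0 + 1) (by omega) (by omega)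
  have hagree : ∀ j : ℤ, (j ∈ Finset.Icc (x - M) (x + 1 + M) ∨ j + 1 ∈ Finset.Icc (x - M) (x + 1 + M) ∨
      j - 1 ∈ Finset.Icc (x - M) (x + 1 + M)) → σ j = σ' j := by
    intro j hj
    simp only [Finset.mem_Icc] at hj
    exact h j (by omega) (by omega)
  have hx0 := severedFlow_apply_eq_of_forall_eq hB1 hU hV _ hagree t (i := x)
    (by rw [Finset.mem_Icc]; omega)
  have hx1 := severedFlow_apply_eq_of_forall_eq hB1 hU hV _ hagree t (i := x + 1)
    (by rw [Finset.mem_Icc]; omega)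
  simp only [OscillatorChain.bondCurrentZ, h0, h1, hx0, hx1]

/-- The finite-chain bond current is the infinite-chain current of the `dite`-embedded configuration. [folklore] -/
theorem bondCurrent_eq_bondCurrentZ_dite {N : ℕ} (i : Fin N) (hi1 : i.val + 1 < N) (z : PhaseSpace N) :
    P.bondCurrent N i z = P.bondCurrentZ
      (fun y : ℤ => if h : 0 ≤ y ∧ y < N then (z.1 ⟨y.toNat, by omega⟩, z.2 ⟨y.toNat, by omega⟩) else (0, 0))
      (i.val : ℤ) := by
  have hd0 : (0 : ℤ) ≤ (i.val : ℤ) ∧ (i.val : ℤ) < N := ⟨by omega, by omega⟩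
  have hd1 : (0 : ℤ) ≤ (i.val : ℤ) + 1 ∧ (i.val : ℤ) + 1 < N := ⟨by omega, by omega⟩
  have e0 : (⟨((i.val : ℤ)).toNat, by omega⟩ : Fin N) = i :=
    Fin.ext (show ((i.val : ℤ)).toNat = i.val by omega)
  have e1 : (⟨((i.val : ℤ) + 1).toNat, by omega⟩ : Fin N) = ⟨i.val + 1, hi1⟩ :=
    Fin.ext (show ((i.val : ℤ) + 1).toNat = i.val + 1 by omega)
  unfold OscillatorChain.bondCurrent OscillatorChain.bondCurrentZ
  dsimp only
  rw [dif_pos hd0, dif_pos hd1, e0, e1]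
  rw [Finset.sum_eq_single ⟨i.val + 1, hi1⟩]
  · simp
  · intro j _ hj
    rw [if_neg]
    intro h
    exact hj (Fin.ext h)
  · intro h; exact absurd (Finset.mem_univ _) h

/-- **The window observable.** For measurable `g_A, g_B` (the clamps divided by their levels), the offset `x`, the
window margin `M`, the time `t` and margins `a ≥ M + 1 - x`, `b ≥ max(1, x + M + 2)`: there is a measurable `f` on
`PhaseSpace (a+b+1)`, with values of the form `g_A(r) g_B(r')`, such that (i)
`f (boxPhaseAt (-a) (a+b) σ) = g_A(j_0 σ) · g_B(j_x(T^{[x-M,x+1+M]}_t σ))` for every `σ`, and (ii) for every chain length `N`,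
anchor `i₀`, bonds `i = i₀ + a`, `k = i + x` with `i + b < N`,
`f(q, p on [i₀, i₀+a+b]) = g_A(j_i(z)) · g_B(j_k(T^{[k-M,k+1+M]}_t (ι_N z)))` with the `dite` embedding `ι_N` of the finite
configuration (zero off `[0, N-1]`). Construction: `f = G ∘ E` with `E` the extension by zero of a window configuration
placed at `[-a, b]`; (i) by locality of `G`; (ii) by locality and the translation covariance of the currents and of the
severed flow (`severedFlow_chainShift`). [folklore] -/
theorem exists_windowObservable (hB1 : P.CondB1) (hU : ContDiff ℝ 2 P.U) (hV : ContDiff ℝ 2 P.V)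
    {gA gB : ℝ → ℝ} (hgA : Measurable gA) (hgB : Measurable gB) (x : ℤ) (M : ℕ) (t : ℝ) {a b : ℕ}
    (hax : (M : ℤ) + 1 - x ≤ a) (hb1 : 1 ≤ b) (hbx : x + M + 2 ≤ (b : ℤ)) :
    ∃ f : PhaseSpace (a + b + 1) → ℝ, Measurable f ∧
      (∀ w, ∃ r r' : ℝ, f w = gA r * gB r') ∧
      (∀ σ : ChainConfig, f (boxPhaseAt (-(a : ℤ)) (a + b) σ) =
          gA (P.bondCurrentZ σ 0) * gB (P.bondCurrentZ (severedFlow hB1 (Finset.Icc (x - M) (x + 1 + M)) t σ) x)) ∧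
      (∀ (N : ℕ) (i₀ i k : Fin N) (h₀ : i₀.val + a = i.val) (hb : i.val + b < N), (k.val : ℤ) = i.val + x →
        ∀ z : PhaseSpace N,
        f (fun j : Fin (a + b + 1) => z.1 ⟨i₀.val + j.val, by omega⟩,
           fun j : Fin (a + b + 1) => z.2 ⟨i₀.val + j.val, by omega⟩) =
          gA (P.bondCurrent N i z) *
            gB (P.bondCurrentZ (severedFlow hB1 (Finset.Icc ((k.val : ℤ) - M) ((k.val : ℤ) + 1 + M)) t
              (fun y : ℤ => if h : 0 ≤ y ∧ y < N then (z.1 ⟨y.toNat, by omega⟩, z.2 ⟨y.toNat, by omega⟩)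
                else (0, 0))) (k.val : ℤ))) := by
  set m : ℕ := a + b with hm
  have hlo0 : -(a : ℤ) ≤ 0 := by omega
  have hlox : -(a : ℤ) ≤ x - M - 1 := by omega
  have hhi1 : (1 : ℤ) ≤ b := by exact_mod_cast hb1
  have hhix : x + M + 2 ≤ (b : ℤ) := hbx
  -- the extension by zero of a window configuration placed at `[-a, b]`
  set E : PhaseSpace (m + 1) → ChainConfig := fun w y =>
    if h : -(a : ℤ) ≤ y ∧ y ≤ b then (w.1 ⟨(y + a).toNat, by omega⟩, w.2 ⟨(y + a).toNat, by omega⟩) else (0, 0)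
    with hE
  have hEm : Measurable E := by
    refine measurable_pi_lambda _ fun y => ?_
    by_cases h : -(a : ℤ) ≤ y ∧ y ≤ b
    · simp only [hE, dif_pos h]
      exact ((measurable_pi_apply _).comp measurable_fst).prodMk ((measurable_pi_apply _).comp measurable_snd)
    · simp only [hE, dif_neg h]
      exact measurable_const
  set G : ChainConfig → ℝ := fun σ =>
    gA (P.bondCurrentZ σ 0) * gB (P.bondCurrentZ (severedFlow hB1 (Finset.Icc (x - M) (x + 1 + M)) t σ) x) with hG
  have hGm : Measurable G := (hgA.comp (measurable_bondCurrentZ P 0)).mul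
    (hgB.comp ((measurable_bondCurrentZ P x).comp (measurable_severedFlow hB1 _ hU hV t)))
  have hGdep : ∀ σ σ' : ChainConfig, (∀ y : ℤ, -(a : ℤ) ≤ y → y ≤ b → σ y = σ' y) → G σ = G σ' :=
    fun σ σ' h => twoCurrent_eq_of_forall_eq hB1 hU hV gA gB x M t hlo0 hlox hhi1 hhix h
  refine ⟨G ∘ E, hGm.comp hEm, fun w => ⟨_, _, rfl⟩, fun σ => ?_, fun N i₀ i k h₀ hbN hk z => ?_⟩
  · -- (i) the infinite chain: `E (boxPhaseAt (-a) m σ)` agrees with `σ` on `[-a, b]`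
    refine hGdep _ _ fun y hy1 hy2 => ?_
    have hy : -(a : ℤ) ≤ y ∧ y ≤ b := ⟨hy1, hy2⟩
    simp only [hE, dif_pos hy, boxPhaseAt_fst, boxPhaseAt_snd]
    have e : -(a : ℤ) + (((y + a).toNat : ℕ) : ℤ) = y := by omega
    rw [e]
  · -- (ii) the finite chain: `E (window of z at i₀)` agrees with `τ_i (ι_N z)` on `[-a, b]`
    set ι : ChainConfig := fun y : ℤ =>
      if h : 0 ≤ y ∧ y < N then (z.1 ⟨y.toNat, by omega⟩, z.2 ⟨y.toNat, by omega⟩) else (0, 0) with hι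
    have hib : i.val + b < N := hbN
    have hi1 : i.val + 1 < N := by omega
    have step1 : (G ∘ E) (fun j : Fin (m + 1) => z.1 ⟨i₀.val + j.val, by omega⟩,
        fun j : Fin (m + 1) => z.2 ⟨i₀.val + j.val, by omega⟩) = G (chainShift (i.val : ℤ) ι) := by
      refine hGdep _ _ fun y hy1 hy2 => ?_
      have hy : -(a : ℤ) ≤ y ∧ y ≤ b := ⟨hy1, hy2⟩
      have hiy : (0 : ℤ) ≤ y + i.val ∧ y + i.val < N := ⟨by omega, by omega⟩
      simp only [hE, dif_pos hy, chainShift_apply, hι, dif_pos hiy]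
      have ef : (⟨i₀.val + ((y + a).toNat : ℕ), by omega⟩ : Fin N) = ⟨(y + (i.val : ℤ)).toNat, by omega⟩ :=
        Fin.ext (show i₀.val + (y + a).toNat = (y + (i.val : ℤ)).toNat by omega)
      rw [ef]
    rw [step1, hG]
    dsimp only
    rw [severedFlow_chainShift hB1 hU hV _ (i.val : ℤ) t ι, bondCurrentZ_chainShift, bondCurrentZ_chainShift,
      zero_add, bondWindow_map_addRight x (i.val : ℤ) (k.val : ℤ) M hk,
      show x + (i.val : ℤ) = (k.val : ℤ) by rw [hk]; ring, bondCurrent_eq_bondCurrentZ_dite i hi1 z]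

/-! ### §3 Shift-invariant states see every window alike -/

/-- For a shift-invariant state the expectation of a measurable window observable does not depend on the position of
the window: `∫ f ∘ boxPhaseAt a m dμ = ∫ f ∘ boxPhaseAt 0 m dμ` (`map_boxPhaseAt_eq_zero_of_map_shift`). [folklore] -/
theorem integral_comp_boxPhaseAt_eq_of_isShiftInvariant {μ : Measure ChainConfig} (hμ : IsShiftInvariant μ)
    (a : ℤ) (m : ℕ) {f : PhaseSpace (m + 1) → ℝ} (hf : Measurable f) :
    ∫ σ, f (boxPhaseAt a m σ) ∂μ = ∫ σ, f (boxPhaseAt 0 m σ) ∂μ := by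
  have h := map_boxPhaseAt_eq_zero_of_map_shift (ν := μ) hμ a m
  rw [← integral_map (measurable_boxPhaseAt a m).aemeasurable hf.aestronglyMeasurable,
    ← integral_map (measurable_boxPhaseAt 0 m).aemeasurable hf.aestronglyMeasurable, h]

end OffsetMatching

open OffsetMatching in
/-- **Registered helper `pinnedChain_windowObservable`** (stub (B′|E1,M1sev) of line `series-law-at-every-laplace-frequency`): the
static identification in closed form. For `P = pinnedChain ω₂ lam β γ` (`ω₂, lam, β > 0`), measurable `g_A, g_B`, an offset `x`, a margin `M`, a time
`t` and window margins `a ≥ M+1-x`, `b ≥ max(1, x+M+2)` there is ONE measurable `f` on `PhaseSpace (a+b+1)`, with values `g_A(r) g_B(r')`, whose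
`boxPhaseAt 0`-expectation in every shift-invariant state is `∫ g_A(j_0) g_B(j_x ∘ T^{[x-M,x+1+M]}_t)` (infinite chain) and which the finite chain
reads, through the window `[i₀, i₀+a+b]` at every anchor `i₀ = i - a` with `k = i + x`, as `g_A(j_i(z)) g_B(j_k(T^{[k-M,k+1+M]}_t(ι_N z)))`
(`ι_N` the `dite` embedding of the stub's signature) — the two formats of (E1) `stub_bulkWindowEquivalence`. [folklore] -/
theorem pinnedChain_windowObservable :
    ∀ ω₂ lam β γ : ℝ, 0 < ω₂ → 0 < lam → 0 < β →
      ∀ (hB1 : (Literature.MathematicalPhysics.KineticTheory.HeatConduction.pinnedChain ω₂ lam β γ).CondB1)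
        (gA gB : ℝ → ℝ), Measurable gA → Measurable gB →
      ∀ (x : ℤ) (M : ℕ) (t : ℝ) (a b : ℕ), (M : ℤ) + 1 - x ≤ a → 1 ≤ b → x + M + 2 ≤ (b : ℤ) →
      ∃ f : Literature.MathematicalPhysics.KineticTheory.HeatConduction.PhaseSpace (a + b + 1) → ℝ, Measurable f ∧
        (∀ w, ∃ r r' : ℝ, f w = gA r * gB r') ∧
        (∀ μ : MeasureTheory.Measure Literature.MathematicalPhysics.KineticTheory.HeatConduction.ChainConfig,
          Literature.MathematicalPhysics.KineticTheory.HeatConduction.IsShiftInvariant μ →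
          ∫ σ, f (Literature.MathematicalPhysics.KineticTheory.HeatConduction.boxPhaseAt 0 (a + b) σ) ∂μ =
            ∫ σ, gA ((Literature.MathematicalPhysics.KineticTheory.HeatConduction.pinnedChain ω₂ lam β γ).bondCurrentZ σ 0) *
              gB ((Literature.MathematicalPhysics.KineticTheory.HeatConduction.pinnedChain ω₂ lam β γ).bondCurrentZ
                (Literature.MathematicalPhysics.KineticTheory.HeatConduction.OscillatorChain.severedFlow hB1
                  (Finset.Icc (x - M) (x + 1 + M)) t σ) x) ∂μ) ∧
        (∀ (N : ℕ) (i₀ i k : Fin N) (h₀ : i₀.val + a = i.val) (hb : i.val + b < N), (k.val : ℤ) = i.val + x →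
          ∀ z : Literature.MathematicalPhysics.KineticTheory.HeatConduction.PhaseSpace N,
          f (fun j : Fin (a + b + 1) => z.1 ⟨i₀.val + j.val, by omega⟩,
             fun j : Fin (a + b + 1) => z.2 ⟨i₀.val + j.val, by omega⟩) =
            gA ((Literature.MathematicalPhysics.KineticTheory.HeatConduction.pinnedChain ω₂ lam β γ).bondCurrent N i z) *
              gB ((Literature.MathematicalPhysics.KineticTheory.HeatConduction.pinnedChain ω₂ lam β γ).bondCurrentZ
                (Literature.MathematicalPhysics.KineticTheory.HeatConduction.OscillatorChain.severedFlow hB1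
                  (Finset.Icc ((k.val : ℤ) - M) ((k.val : ℤ) + 1 + M)) t
                  (fun y : ℤ => if h : 0 ≤ y ∧ y < N then (z.1 ⟨y.toNat, by omega⟩, z.2 ⟨y.toNat, by omega⟩)
                    else (0, 0))) (k.val : ℤ))) := by
  intro ω₂ lam β γ hω hl hβ hB1 gA gB hgA hgB x M t a b hax hb1 hbx
  have hU : ContDiff ℝ 2 (pinnedChain ω₂ lam β γ).U := (pinnedChain_isEvenPolyOfDegree_U β γ hω.le hl).contDiff_two
  have hV : ContDiff ℝ 2 (pinnedChain ω₂ lam β γ).V := (pinnedChain_isEvenPolyOfDegree_V ω₂ lam γ hβ).contDiff_two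
  obtain ⟨f, hfm, hfrs, hfinf, hffin⟩ :=
    exists_windowObservable (P := pinnedChain ω₂ lam β γ) hB1 hU hV hgA hgB x M t hax hb1 hbx
  refine ⟨f, hfm, hfrs, fun μ hμ => ?_, hffin⟩
  rw [← integral_comp_boxPhaseAt_eq_of_isShiftInvariant hμ (-(a : ℤ)) (a + b) hfm]
  exact integral_congr_ae (Eventually.of_forall hfinf)



end Summit.AtomisticToContinuum.FouriersLaw.Theorems.AbelThermodynamicLimit.SeriesLawAtEveryLaplaceFrequency

end
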